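import Summits.AtomisticToContinuum.HydrodynamicLimit.Theses.MourreKoopmanCharges
import Literature.MathematicalPhysics.KineticTheory.FluctuationUnitaryGroup
import Literature.Analysis.UnboundedOperators.VirialTheorem
import HarnessLib

/-!
# `ConservedVectorsOneBody` (stmt-AtomisticToContinuum-14142): the virial glue, proved

Support file for the support item `ConservedVectorsOneBody` of route `MourreKoopmanCharges`
(`Summit.AtomisticToContinuum.HydrodynamicLimit.Theses.MourreKoopmanCharges.ConservedVectorsOneBody`):
for the low-activity hard-sphere Gibbs state driven by Alexander's flow, every Koopman-invariant
vector of Spohn's fluctuation space lies in the one-body velocity sector,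
`F.conservedSpace ≤ F.oneBodySector`. The item is the typed deliverable "(a)" of the route's
INFORMAL engine crux `CollisionCommutatorRegularityR` (stmt-13984: a flow-adapted conjugate operator
`A` with `(A, N)`-regularity of the Koopman generator and WEAK CONJUGACY off `𝒟`: the commutator form
`i[H, A]` is `≥ 0` with kernel inside `𝒟`), through the virial theorem. Its content is the open
"no hidden many-body charge" half of the finite-dimensionality problem for the conserved charges of
the infinite hard-sphere gas (Doyon 2022 §1; Spohn 1991 Part I §7.1); nothing in the tree or in print
proves it, and the engine is not a Lean statement yet.

What this file PROVES is the functional-analytic shell every proof along the route must pass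
through, in the tree's vocabulary:

* §1 (real Koopman group, any `FluctuationDynamics`): the VIRIAL IDENTITY
  `⟪ψ, C(U_t ψ)⟫ = ⟪ψ, U_t(C ψ)⟫` for invariant `ψ` and an arbitrary map `C` of `ℋ` (no continuity
  in `t` is needed: `U_t* = U_{-t}` fixes `ψ` too); the reduction
  `conservedSpace ≤ S ↔ Sᗮ ⊥ conservedSpace` for a closed `S`; and the MIXING CRITERION: if every
  vector orthogonal to `S` has time correlations `⟪U_t φ, ψ⟫` of arbitrarily small modulus, the
  conserved space lies in `S` (the Cesàro/mean-ergodic road to the item, engine-free).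
* §2 (complexified picture, `HardSphereFluctuationData` with strongly continuous Koopman group, the
  setting of `FluctuationUnitaryGroup` / `ConjugateOperatorRegularity`): by the virial theorem of
  `Literature/Analysis/UnboundedOperators/VirialTheorem.lean` (ABG Prop. 7.2.10, `C¹(A)` form),
  the commutator `[S, iA]` of ANY bounded `S ∈ C¹(A; ℋ_ℂ)` that acts as a scalar on the invariant
  vectors — `S = U(t)`, or `S = (𝓛 + i)⁻¹` when the Liouvillean is of class `C¹(A)` — has vanishing
  expectation in every conserved vector; hence WEAK CONJUGACY OFF `𝒟` of that commutator form
  (`⟪u, [S, iA] u⟫ = 0 ⇒ u ∈ 𝒟_ℂ`, clause (v) of stmt-13984 in the `C¹(A)` class) gives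
  `conservedSpace ≤ oneBodySector` (`conservedSpace_le_oneBodySector_of_hasCommutator`, with the
  two instances `…_of_koopman_C1`, `…_of_liouvillean_C1`).
* §3 the item's own quantifier shape: `ConservedVectorsOneBody` follows from the existence, for
  every low-activity Gibbs datum with Alexander flow, of such a weakly conjugate `C¹(A)` commutator
  (`conservedVectorsOneBody_of_weaklyConjugateCommutator`) — the typed form, in the simplest
  regularity class, of "13984 ⇒ 14142". The `(A, N)`-regular virial theorem the informal crux
  actually asks for (Georgescu–Gérard–Møller 2004; ABG Prop. 7.5.1) is not in the tree.

References: Amrein–Boutet de Monvel–Georgescu 1996, Prop. 7.2.10; Mourre 1981, Prop. II.4;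
Spohn 1991, Part I §7.1; Doyon 2022, §4.4–§5.
-/

noncomputable section

open Filter Set MeasureTheory
open scoped InnerProductSpace ComplexConjugate Topology

namespace Summit.AtomisticToContinuum.HydrodynamicLimit.Theorems

open Literature.MathematicalPhysics.KineticTheory Literature.Analysis.UnboundedOperators
open Summit.AtomisticToContinuum.HydrodynamicLimit.Theses.MourreKoopmanCharges (ConservedVectorsOneBody)

namespace MourreKoopmanChargesConservedVectorsOneBody

/-! ## §1. The real Koopman group: virial identity, orthogonality reduction, mixing criterion -/

section Real

variable {G Ω : Type*} [AddCommGroup G] [MeasurableSpace G] [MeasurableSpace Ω]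
  {ν : MeasureTheory.Measure G} {T : ShiftAction G Ω} (D : FluctuationDynamics ν T)
  [MeasurableNeg G] [ν.IsNegInvariant]

/-- Time correlations against a conserved vector are constant: `⟪U_t φ, ψ⟫ = ⟪φ, ψ⟫` for
`ψ ∈ 𝒬₀` (`U_t* = U_{-t}` fixes `ψ`). [folklore] -/
theorem inner_koopman_left_of_mem_conservedSpace {ψ : D.FluctuationSpace}
    (hψ : ψ ∈ D.conservedSpace) (φ : D.FluctuationSpace) (t : ℝ) :
    ⟪D.koopman t φ, ψ⟫_ℝ = ⟪φ, ψ⟫_ℝ := by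
  rw [D.inner_koopman_left_eq, hψ (-t)]

/-- **The virial identity of the real Koopman group**: for a conserved vector `ψ` and ANY map `C`
of `ℋ` (a regularised conjugate operator, a bounded function of one, …) and every `t`,
`⟪ψ, C (U_t ψ)⟫ = ⟪ψ, U_t (C ψ)⟫`, i.e. the "commutator" `C U_t - U_t C` has zero expectation in
`ψ` — with no continuity of `t ↦ U_t`. Every positive-commutator argument for the item is applied
through this identity. [folklore] -/
theorem inner_apply_koopman_eq_inner_koopman_apply {ψ : D.FluctuationSpace}
    (hψ : ψ ∈ D.conservedSpace) (C : D.FluctuationSpace → D.FluctuationSpace) (t : ℝ) :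
    ⟪ψ, C (D.koopman t ψ)⟫_ℝ = ⟪ψ, D.koopman t (C ψ)⟫_ℝ := by
  rw [hψ t, ← neg_neg t, ← D.inner_koopman_left_eq, hψ (-t)]

/-- Commutator form of the virial identity: `⟪ψ, C (U_t ψ) - U_t (C ψ)⟫ = 0` for conserved `ψ`.
[folklore] -/
theorem inner_commutator_koopman_eq_zero {ψ : D.FluctuationSpace} (hψ : ψ ∈ D.conservedSpace)
    (C : D.FluctuationSpace → D.FluctuationSpace) (t : ℝ) :
    ⟪ψ, C (D.koopman t ψ) - D.koopman t (C ψ)⟫_ℝ = 0 := by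
  rw [inner_sub_right, inner_apply_koopman_eq_inner_koopman_apply D hψ C t, sub_self]

/-- **Orthogonality reduction**: for a closed subspace `S` (one with an orthogonal projection),
`𝒬₀ ≤ S` iff every vector orthogonal to `S` is orthogonal to every conserved vector. [folklore] -/
theorem conservedSpace_le_iff_forall_inner_eq_zero (S : Submodule ℝ D.FluctuationSpace)
    [S.HasOrthogonalProjection] :
    D.conservedSpace ≤ S ↔ ∀ ψ ∈ D.conservedSpace, ∀ φ ∈ Sᗮ, ⟪φ, ψ⟫_ℝ = 0 := by
  constructor
  · intro h ψ hψ φ hφ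
    exact Submodule.inner_left_of_mem_orthogonal (h hψ) hφ
  · intro h ψ hψ
    rw [← Submodule.orthogonal_orthogonal S, Submodule.mem_orthogonal]
    exact fun φ hφ => h ψ hψ φ hφ

/-- `𝒬₀ ≤ S` iff `Sᗮ ≤ 𝒬₀ᗮ` (both closed). [folklore] -/
theorem conservedSpace_le_iff_orthogonal_le (S : Submodule ℝ D.FluctuationSpace)
    [S.HasOrthogonalProjection] : D.conservedSpace ≤ S ↔ Sᗮ ≤ D.conservedSpaceᗮ := by
  rw [conservedSpace_le_iff_forall_inner_eq_zero D S]
  constructor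
  · intro h φ hφ
    rw [Submodule.mem_orthogonal']
    exact fun ψ hψ => h ψ hψ φ hφ
  · intro h ψ hψ φ hφ
    exact (Submodule.mem_orthogonal' _ _).1 (h hφ) ψ hψ

/-- **Drude-weight form** (Mazur): `𝒬₀ ≤ S` iff every vector orthogonal to `S` has zero Drude
weight `𝖣_φ = ‖P_{𝒬₀} φ‖²` — "no ballistic transport off `S`". [folklore] -/
theorem conservedSpace_le_iff_forall_drudeWeight_eq_zero (S : Submodule ℝ D.FluctuationSpace)
    [S.HasOrthogonalProjection] :
    D.conservedSpace ≤ S ↔ ∀ φ ∈ Sᗮ, D.drudeWeight φ = 0 := by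
  rw [conservedSpace_le_iff_orthogonal_le D S]
  simp_rw [D.drudeWeight_eq_zero_iff]
  rfl

/-- **Mixing criterion** (the engine-free road): if every vector `φ` orthogonal to the closed
subspace `S` has time correlations `⟪U_t φ, ψ⟫` of arbitrarily small modulus against every `ψ`
(e.g. `U_t φ ⇀ 0` weakly, or along a sequence, or in Cesàro mean), then every conserved vector lies
in `S`: against a conserved `ψ` the correlation is the constant `⟪φ, ψ⟫`. [folklore] -/
theorem conservedSpace_le_of_small_correlations (S : Submodule ℝ D.FluctuationSpace)
    [S.HasOrthogonalProjection]
    (h : ∀ φ ∈ Sᗮ, ∀ ψ : D.FluctuationSpace, ∀ ε : ℝ, 0 < ε → ∃ t : ℝ, |⟪D.koopman t φ, ψ⟫_ℝ| < ε) :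
    D.conservedSpace ≤ S := by
  rw [conservedSpace_le_iff_forall_inner_eq_zero D S]
  intro ψ hψ φ hφ
  by_contra hne
  obtain ⟨t, ht⟩ := h φ hφ ψ |⟪φ, ψ⟫_ℝ| (abs_pos.2 hne)
  rw [inner_koopman_left_of_mem_conservedSpace D hψ φ t] at ht
  exact lt_irrefl _ ht

end Real

/-! ## §2. Hard spheres, complexified picture: virial theorem ⇒ weak conjugacy closes the item -/

section HardSpheres

variable {σ : ℝ} (F : HardSphereFluctuationData σ)

/-- The one-body sector `𝒟` is closed in the Hilbert space `ℋ` (it is a closure), hence complete and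
it has an orthogonal projection (stated as a theorem, used via `haveI`). [folklore] -/
theorem hasOrthogonalProjection_oneBodySector : F.oneBodySector.HasOrthogonalProjection := by
  haveI : CompleteSpace F.oneBodySector := by
    rw [HardSphereFluctuationData.oneBodySector]
    exact (Submodule.isClosed_topologicalClosure _).completeSpace_coe
  exact Submodule.HasOrthogonalProjection.ofCompleteSpace _

/-- **The item for one datum, in Drude-weight form**: `F.conservedSpace ≤ F.oneBodySector` iff
every vector of `ℋ` orthogonal to the one-body sector has zero Drude weight (no hidden many-body
charge ⟺ no ballistic weight off `𝒟`; the Mazur-bound reading used by the torus cruxes). [folklore] -/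
theorem conservedSpace_le_oneBodySector_iff_drudeWeight :
    F.conservedSpace ≤ F.oneBodySector ↔ ∀ φ ∈ F.oneBodySectorᗮ, F.drudeWeight φ = 0 := by
  haveI := hasOrthogonalProjection_oneBodySector F
  exact conservedSpace_le_iff_forall_drudeWeight_eq_zero F.toFluctuationDynamics F.oneBodySector

/-- **Mixing off the one-body sector suffices** (engine-free road, for one datum): if every vector
orthogonal to `𝒟` has time correlations of arbitrarily small modulus, then
`F.conservedSpace ≤ F.oneBodySector`. [folklore] -/
theorem conservedSpace_le_oneBodySector_of_small_correlations
    (h : ∀ φ ∈ F.oneBodySectorᗮ, ∀ ψ : HardSphereFluctuationSpace F, ∀ ε : ℝ, 0 < ε →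
      ∃ t : ℝ, |⟪F.koopman t φ, ψ⟫_ℝ| < ε) :
    F.conservedSpace ≤ F.oneBodySector := by
  haveI := hasOrthogonalProjection_oneBodySector F
  exact conservedSpace_le_of_small_correlations F.toFluctuationDynamics F.oneBodySector h

/-- A conserved vector, complexified, is an invariant vector of the unitary Koopman group `U(t)` on
`ℋ_ℂ` (`invariantVectors U = (𝒬₀)_ℂ`). [folklore] -/
theorem ofReal_mem_invariantVectors (h : F.IsStronglyContinuous) {ψ : HardSphereFluctuationSpace F}
    (hψ : ψ ∈ F.conservedSpace) :
    Complexification.ofReal ψ ∈ (F.unitaryGroup h).invariantVectors := by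
  rw [FluctuationDynamics.invariantVectors_unitaryGroup, Complexification.mem_submodule_iff]
  exact ⟨hψ, by simp⟩

/-- **Virial theorem for the hard-sphere Koopman group** (frequency `0`): if `U(t) ∈ C¹(A; ℋ_ℂ)`
for some conjugate group `A` and time `t`, with commutator `Dc = [U(t), iA]`, then
`⟪ψ₁, Dc ψ₂⟫ = 0` for all conserved `ψ₁, ψ₂` (ABG Prop. 7.2.10 through
`UnitaryRep.inner_eq_zero_of_mem_invariantVectors_appReal`). [folklore] -/
theorem inner_commutator_koopmanUnitary_eq_zero (h : F.IsStronglyContinuous)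
    {A : OneParameterUnitaryGroup (Complexification (HardSphereFluctuationSpace F))} {t : ℝ}
    {Dc : Complexification (HardSphereFluctuationSpace F) →L[ℂ]
      Complexification (HardSphereFluctuationSpace F)}
    (hc : A.HasCommutator ((F.unitaryGroup h).appReal t) Dc)
    {ψ₁ ψ₂ : HardSphereFluctuationSpace F} (hψ₁ : ψ₁ ∈ F.conservedSpace)
    (hψ₂ : ψ₂ ∈ F.conservedSpace) :
    ⟪Complexification.ofReal ψ₁, Dc (Complexification.ofReal ψ₂)⟫_ℂ = 0 :=
  (F.unitaryGroup h).inner_eq_zero_of_mem_invariantVectors_appReal hc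
    (ofReal_mem_invariantVectors F h hψ₁) (ofReal_mem_invariantVectors F h hψ₂)

/-- **Virial theorem for the hard-sphere Liouvillean of class `C¹(A)`**: if `𝓛` is of class
`C¹(A)` (its resolvent `(𝓛 + i)⁻¹ ∈ C¹(A; ℋ_ℂ)`), the commutator `[(𝓛 + i)⁻¹, iA]` has vanishing
matrix elements between conserved vectors. [folklore] -/
theorem inner_commutator_resolvent_eq_zero (h : F.IsStronglyContinuous)
    {A : OneParameterUnitaryGroup (Complexification (HardSphereFluctuationSpace F))}
    (hH : (F.unitaryGroup h).HamiltonianOfClassC1 A)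
    {ψ₁ ψ₂ : HardSphereFluctuationSpace F} (hψ₁ : ψ₁ ∈ F.conservedSpace)
    (hψ₂ : ψ₂ ∈ F.conservedSpace) :
    ⟪Complexification.ofReal ψ₁,
      A.commutatorCLM (F.unitaryGroup h).resolventNegI (Complexification.ofReal ψ₂)⟫_ℂ = 0 :=
  (F.unitaryGroup h).inner_commutator_resolventNegI_eq_zero hH
    (ofReal_mem_invariantVectors F h hψ₁) (ofReal_mem_invariantVectors F h hψ₂)

/-- **Closing schema — virial theorem + weak conjugacy off `𝒟` ⇒ the item's conclusion.** Let the
hard-sphere Koopman group be strongly continuous, and let `S ∈ C¹(A; ℋ_ℂ)` be a bounded operator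
with commutator `Dc = [S, iA]` which acts as a scalar on every invariant vector `u` (`S u = c u`,
`⟪u, S x⟫ = c ⟪u, x⟫`: any bounded function of the Liouvillean realised through the group —
`U(t)`, smeared operators, the resolvent). If the commutator form is WEAKLY CONJUGATE OFF `𝒟`,
i.e. `⟪u, Dc u⟫ = 0` forces `u ∈ 𝒟_ℂ` (clause (v) of the informal crux stmt-13984, in the `C¹(A)`
class), then every conserved vector lies in the one-body sector. [folklore] -/
theorem conservedSpace_le_oneBodySector_of_hasCommutator (h : F.IsStronglyContinuous)
    {A : OneParameterUnitaryGroup (Complexification (HardSphereFluctuationSpace F))}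
    {S Dc : Complexification (HardSphereFluctuationSpace F) →L[ℂ]
      Complexification (HardSphereFluctuationSpace F)}
    (hc : A.HasCommutator S Dc)
    (hS : ∀ u ∈ (F.unitaryGroup h).invariantVectors,
      ∃ c : ℂ, S u = c • u ∧ ∀ x, ⟪u, S x⟫_ℂ = c * ⟪u, x⟫_ℂ)
    (hker : ∀ u, ⟪u, Dc u⟫_ℂ = 0 → u ∈ F.oneBodySectorC) :
    F.conservedSpace ≤ F.oneBodySector := by
  intro ψ hψ
  have hu := ofReal_mem_invariantVectors F h hψ
  obtain ⟨c, hc1, hc2⟩ := hS _ hu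
  have hvirial := hc.inner_eq_zero_of_eigenvector hc1 hc2
  have hmem := hker _ hvirial
  rw [HardSphereFluctuationData.mem_oneBodySectorC_iff] at hmem
  simpa using hmem.1

/-- **Instance `S = U(t)`** ("13984-lite"): a conjugate group `A` and a time `t` with
`U(t) ∈ C¹(A; ℋ_ℂ)` whose commutator form vanishes only on `𝒟_ℂ` put the conserved space inside the
one-body sector. [folklore] -/
theorem conservedSpace_le_oneBodySector_of_koopman_C1 (h : F.IsStronglyContinuous)
    {A : OneParameterUnitaryGroup (Complexification (HardSphereFluctuationSpace F))} {t : ℝ}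
    {Dc : Complexification (HardSphereFluctuationSpace F) →L[ℂ]
      Complexification (HardSphereFluctuationSpace F)}
    (hc : A.HasCommutator ((F.unitaryGroup h).appReal t) Dc)
    (hker : ∀ u, ⟪u, Dc u⟫_ℂ = 0 → u ∈ F.oneBodySectorC) :
    F.conservedSpace ≤ F.oneBodySector :=
  conservedSpace_le_oneBodySector_of_hasCommutator F h hc
    (fun u hu => ⟨1, by rw [one_smul]; exact ((F.unitaryGroup h).mem_invariantVectors_iff u).1 hu _,
      fun x => by rw [one_mul, (F.unitaryGroup h).inner_appReal_apply_of_mem_invariantVectors hu]⟩)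
    hker

/-- **Instance `S = (𝓛 + i)⁻¹`** (ABG's setting): if the hard-sphere Liouvillean is of class `C¹(A)`
and the commutator form `⟪u, [(𝓛 + i)⁻¹, iA] u⟫` vanishes only on `𝒟_ℂ`, the conserved space lies
inside the one-body sector. [folklore] -/
theorem conservedSpace_le_oneBodySector_of_liouvillean_C1 (h : F.IsStronglyContinuous)
    {A : OneParameterUnitaryGroup (Complexification (HardSphereFluctuationSpace F))}
    (hH : (F.unitaryGroup h).HamiltonianOfClassC1 A)
    (hker : ∀ u, ⟪u, A.commutatorCLM (F.unitaryGroup h).resolventNegI u⟫_ℂ = 0 →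
      u ∈ F.oneBodySectorC) :
    F.conservedSpace ≤ F.oneBodySector := by
  set U := F.unitaryGroup h
  have hfix : ∀ u ∈ U.invariantVectors, ∀ a : ℝ, U.appReal a u = u := fun u hu a =>
    (U.mem_invariantVectors_iff u).1 hu _
  refine conservedSpace_le_oneBodySector_of_hasCommutator F h
    (UnitaryRep.IsOfClassC1.hasCommutator hH)
    (fun u hu => ⟨∫ a, UnitaryRep.resolventKernel a, ?_, fun x => ?_⟩) hker
  · rw [U.resolventNegI_apply]
    simp_rw [hfix u hu]
    exact integral_smul_const UnitaryRep.resolventKernel u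
  · rw [U.resolventNegI_apply, U.inner_integral_smul_appReal UnitaryRep.integrable_resolventKernel]
    simp_rw [U.inner_appReal_apply_of_mem_invariantVectors hu]
    exact MeasureTheory.integral_mul_const _ UnitaryRep.resolventKernel

end HardSpheres

/-! ## §3. The item's shape: a weakly conjugate `C¹(A)` commutator for every low-activity Gibbs
datum gives `ConservedVectorsOneBody` -/

/-- **`ConservedVectorsOneBody` from a typed engine in the `C¹(A)` class.** If for every diameter
`σ > 0` and inverse temperature `β > 0` there is an activity threshold `z₀` below which every
hard-sphere fluctuation datum `F` in the Gibbs state with (a.e.) Alexander flow has a strongly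
continuous Koopman group admitting a conjugate group `A` and a time `t` with `U(t) ∈ C¹(A; ℋ_ℂ)`
whose commutator form is weakly conjugate off `𝒟` (vanishes only on `𝒟_ℂ`), then the route item
`ConservedVectorsOneBody` holds — by the virial theorem. This is the simplest typed form of
"informal crux stmt-13984 (consequence (a)) ⇒ stmt-14142"; it does not assert its hypothesis.
[folklore] -/
theorem conservedVectorsOneBody_of_weaklyConjugateCommutator
    (hyp : ∀ σ : ℝ, 0 < σ → ∀ β : ℝ, 0 < β → ∃ z₀ : ℝ, 0 < z₀ ∧ ∀ z : ℝ, 0 < z → z < z₀ →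
      ∀ F : HardSphereFluctuationData σ,
        Literature.Analysis.FluidPDE.IsHardSphereGibbs σ z β (0 : V3) F.μ →
        (∃ Φ : Literature.Analysis.FluidPDE.InfiniteHardSphereFlow (Fin 3) σ,
          Φ.IsEquilibriumFlow ∧ ∀ t : ℝ, F.flow t =ᵐ[F.μ] Φ.flow t) →
        ∃ (h : F.IsStronglyContinuous)
          (A : OneParameterUnitaryGroup (Complexification (HardSphereFluctuationSpace F))) (t : ℝ)
          (Dc : Complexification (HardSphereFluctuationSpace F) →L[ℂ]
            Complexification (HardSphereFluctuationSpace F)),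
          A.HasCommutator ((F.unitaryGroup h).appReal t) Dc ∧
            ∀ u, ⟪u, Dc u⟫_ℂ = 0 → u ∈ F.oneBodySectorC) :
    ConservedVectorsOneBody := by
  intro σ hσ β hβ
  obtain ⟨z₀, hz₀, hz⟩ := hyp σ hσ β hβ
  refine ⟨z₀, hz₀, fun z hz1 hz2 F hG hΦ => ?_⟩
  obtain ⟨h, A, t, Dc, hc, hker⟩ := hz z hz1 hz2 F hG hΦ
  exact conservedSpace_le_oneBodySector_of_koopman_C1 F h hc hker

end MourreKoopmanChargesConservedVectorsOneBody

end Summit.AtomisticToContinuum.HydrodynamicLimit.Theorems
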